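import Literature.AnabelianGeometry.SemiGraphs.TemperedVerticial
import HarnessLib

/-!
# Generic constructors for [SemiAnbd] Def. 2.4 (i) «elevated» and (iv) «aloof / estranged» in the local presentation

S. Mochizuki, *Semi-graphs of anabelioids*, Publ. RIMS **42** (2006), Def. 2.4 (i) p. 25 («there exists a
`π₁`-epimorphic approximator `𝒢 → 𝒢'` … a subgroup `N_M ⊆ π̂₁(𝒢'_v)` of order `≥ M` which has trivial
intersection with all of the conjugates … of all of the `π̂₁(𝒢'_e)`»), Def. 2.4 (iv) p. 26 (aloof /
estranged) and Rmk. 2.4.1 («estranged implies aloof»), for the tree's `ProfiniteSemiGraph` predicates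
`IsElevatedVertex` / `IsTotallyElevated` / `IsAloofEdge` / `IsEstrangedEdge` (`TemperedVerticial.lean`).

PROOF-ONLY, no definition, no named fact.  Two generic constructors, valid for ANY `ProfiniteSemiGraph`:
* `isTotallyEstranged_and_isTotallyAloof_of_forall_inf_conj_eq_bot`: if every branch subgroup `Π_b ⊆ Π_v` is
  infinite and `Π_b ∩ g Π_{b'} g⁻¹ = 1` whenever `b' ≠ b` or `g ∉ Π_b`, then `𝒢` is totally estranged AND totally
  aloof (infinite index from triviality in an infinite group, `relIndex_eq_zero_of_inf_eq_bot_of_infinite`);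
* `isElevatedVertex_of_comm_approximators` / `isTotallyElevated_of_comm_approximators`: if the approximators
  can be chosen with COMMUTATIVE vertex group at `v`, the conjugates in Def. 2.4 (i) are irrelevant and a
  subgroup meeting the branch IMAGES trivially suffices — print (p. 25, own render) quantifies over ANY
  `π₁`-epimorphic approximator, so abelian quotients are admissible and no Lie-layer (Lazard/Witt) count is needed;
plus the finite-group core used at abelianised levels `(ℤ/q)²`: `inr_range_inf_graph_range_eq_bot`
(`0 × R` meets the graph `{(x, c·x)}` trivially for EVERY `c`), `card_inr_range_zmod`, `graph_injective`,
`map_conj_eq_self_of_comm`.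

Cell context (abc-iut, layer L3, FRONTIER programme SUBDAG-REFUTE-F1732, brick R5 part 1, seat abc-iut-w6-d102):
these are the object-independent lemmas behind the hypotheses (H3) «totally estranged» and (H6) «totally
elevated» of the ray-of-groups semi-graph `𝒢_θ` — towards a kernel erratum for the ∀-countable reading of
[SemiAnbd] Thm 3.7 (iii) ([IUTchI] Rmk 2.5.3); desk countermodel abc-iut-L3-d1 g3 (memo 8b26b5199c29f55f);
print proves finite `𝔾` (kernel: p431007).  Nothing here bears on [IUTchIII] Cor. 3.12 or asserts anything
about any particular semi-graph; typed ≠ proved. [cite: MochizukiSemiAnbd2006, Def 2.4 p.25-26]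
-/

namespace Literature.AnabelianGeometry.SemiGraphs

namespace ProfiniteSemiGraph

universe u

variable (𝒢 : ProfiniteSemiGraph.{u})

/-- Infinite index from a trivial intersection: if `A` is infinite and `A ⊓ H = ⊥` then `H` has relative
index `0` (= infinite index) in `A` (Rmk. 2.4.1 «estranged implies aloof», p. 26, for infinite `Π_b`).
[cite: MochizukiSemiAnbd2006, Rmk 2.4.1 p.26] -/
theorem relIndex_eq_zero_of_inf_eq_bot_of_infinite {G : Type*} [Group G] {A H : Subgroup G}
    (hA : (A : Set G).Infinite) (h : A ⊓ H = ⊥) : H.relIndex A = 0 := by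
  have hd : Disjoint H A := by
    rw [disjoint_iff, inf_comm, h]
  haveI : Infinite A := hA.to_subtype
  rw [Subgroup.relIndex, Subgroup.subgroupOf_eq_bot.mpr hd, Subgroup.index_bot]
  exact Nat.card_eq_zero_of_infinite

/-- **Generic constructor for Def. 2.4 (iv)**: if every branch subgroup `Π_b ⊆ Π_v` is infinite and, at every
vertex `v`, `Π_b ∩ g Π_{b'} g⁻¹ = 1` whenever `b' ≠ b` or `g ∉ Π_b` (both abutting to `v`), then `𝒢` is totally
estranged and totally aloof. [cite: MochizukiSemiAnbd2006, Def 2.4(iv) p.26] -/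
theorem isTotallyEstranged_and_isTotallyAloof_of_forall_inf_conj_eq_bot
    (hinf : ∀ (b : 𝒢.graph.Branch) (v : 𝒢.graph.Vertex) (h : 𝒢.graph.abuts b = some v),
      ((𝒢.branchSubgroup b v h : Subgroup (𝒢.Gv v)) : Set (𝒢.Gv v)).Infinite)
    (hbot : ∀ (v : 𝒢.graph.Vertex) (b : 𝒢.graph.Branch) (h : 𝒢.graph.abuts b = some v)
      (b' : 𝒢.graph.Branch) (h' : 𝒢.graph.abuts b' = some v) (g : 𝒢.Gv v),
      (b' ≠ b ∨ g ∉ 𝒢.branchSubgroup b v h) →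
        𝒢.branchSubgroup b v h ⊓ (𝒢.branchSubgroup b' v h').map (MulAut.conj g).toMonoidHom = ⊥) :
    𝒢.IsTotallyEstranged ∧ 𝒢.IsTotallyAloof := by
  have haloof : 𝒢.IsTotallyAloof := by
    intro e b _ v h b' h' g hg
    exact relIndex_eq_zero_of_inf_eq_bot_of_infinite (hinf b v h) (hbot v b h b' h' g hg)
  refine ⟨fun e => ⟨haloof e, ?_⟩, haloof⟩
  intro b _ v h b' h' g hg
  exact hbot v b h b' h' g hg

/-- Corollary: total estrangedness alone. [cite: MochizukiSemiAnbd2006, Def 2.4(iv) p.26] -/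
theorem isTotallyEstranged_of_forall_inf_conj_eq_bot
    (hinf : ∀ (b : 𝒢.graph.Branch) (v : 𝒢.graph.Vertex) (h : 𝒢.graph.abuts b = some v),
      ((𝒢.branchSubgroup b v h : Subgroup (𝒢.Gv v)) : Set (𝒢.Gv v)).Infinite)
    (hbot : ∀ (v : 𝒢.graph.Vertex) (b : 𝒢.graph.Branch) (h : 𝒢.graph.abuts b = some v)
      (b' : 𝒢.graph.Branch) (h' : 𝒢.graph.abuts b' = some v) (g : 𝒢.Gv v),
      (b' ≠ b ∨ g ∉ 𝒢.branchSubgroup b v h) →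
        𝒢.branchSubgroup b v h ⊓ (𝒢.branchSubgroup b' v h').map (MulAut.conj g).toMonoidHom = ⊥) :
    𝒢.IsTotallyEstranged :=
  (𝒢.isTotallyEstranged_and_isTotallyAloof_of_forall_inf_conj_eq_bot hinf hbot).1

/-! ### §2 Elevation in an ABELIAN approximator quotient (no Lazard) -/

/-- In a commutative group conjugation is trivial on subgroups. [cite: MochizukiSemiAnbd2006, Def 2.4(i) p.25] -/
theorem map_conj_eq_self_of_comm {F : Type*} [CommGroup F] (B : Subgroup F) (g : F) :
    B.map (MulAut.conj g).toMonoidHom = B := by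
  ext x
  constructor
  · rintro ⟨y, hy, rfl⟩
    simpa [MulAut.conj_apply] using hy
  · intro hx
    exact ⟨x, hx, by simp [MulAut.conj_apply]⟩

/-- The «second coordinate axis» `N = 0 × ℤ/q` of `(ℤ/q)²` meets the graph `{(x, c·x)}` of multiplication by
ANY `c` trivially: `(0, y) = (x, c x) ⇒ x = 0 ⇒ y = 0`.  This is the whole content of the elevation of the
vertices of `𝒢_θ` (branch images `⟨(1,0)⟩`, `⟨(1,p^{n})⟩` in the abelianised level-`p^s` quotient).
[cite: MochizukiSemiAnbd2006, Def 2.4(i) p.25] -/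
theorem inr_range_inf_graph_range_eq_bot {R : Type*} [CommRing R] (c : R) :
    (AddMonoidHom.inr R R).range.toSubgroup ⊓
      (((AddMonoidHom.id R).prod (AddMonoidHom.mulLeft c)).range.toSubgroup) = ⊥ := by
  rw [eq_bot_iff]
  intro z hz
  rw [Subgroup.mem_inf, Multiplicative.mem_toSubgroup, Multiplicative.mem_toSubgroup] at hz
  obtain ⟨⟨y, hy⟩, ⟨x, hx⟩⟩ := hz
  rw [Subgroup.mem_bot]
  have hy' : ((0 : R), y) = Multiplicative.toAdd z := by simpa using hy
  have hx' : (x, c * x) = Multiplicative.toAdd z := by simpa using hx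
  have hx0 : x = 0 := by
    have := congrArg Prod.fst (hx'.trans hy'.symm)
    simpa using this
  have h0 : Multiplicative.toAdd z = 0 := by
    rw [← hx', hx0, mul_zero]; rfl
  exact Multiplicative.toAdd.injective h0

/-- `|0 × ℤ/q| = q`. [cite: MochizukiSemiAnbd2006, Def 2.4(i) p.25] -/
theorem card_inr_range_zmod (q : ℕ) [NeZero q] :
    Nat.card ((AddMonoidHom.inr (ZMod q) (ZMod q)).range.toSubgroup) = q := by
  have e1 : ((AddMonoidHom.inr (ZMod q) (ZMod q)).range.toSubgroup) ≃
      (AddMonoidHom.inr (ZMod q) (ZMod q)).range :=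
    Equiv.subtypeEquiv Multiplicative.toAdd (fun z => by rw [Multiplicative.mem_toSubgroup])
  have e2 : ZMod q ≃ (AddMonoidHom.inr (ZMod q) (ZMod q)).range :=
    (AddMonoidHom.ofInjective (f := AddMonoidHom.inr (ZMod q) (ZMod q))
      (fun a b h => by simpa using congrArg Prod.snd h)).toEquiv
  rw [Nat.card_congr e1, ← Nat.card_congr e2, Nat.card_zmod]

/-- The graph map `x ↦ (x, c·x)` is injective (the approximator is of injective type).
[cite: MochizukiSemiAnbd2006, Def 2.3(i) p.24] -/
theorem graph_injective {R : Type*} [CommRing R] (c : R) :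
    Function.Injective ((AddMonoidHom.id R).prod (AddMonoidHom.mulLeft c)) := fun _ _ h =>
  congrArg Prod.fst h

/-- **Generic constructor for Def. 2.4 (i) at a vertex with COMMUTATIVE approximator groups**: if for every
`M` there is a `π₁`-epimorphic approximator whose vertex group at `v` is commutative and contains a subgroup of
order `≥ M` meeting every branch IMAGE trivially, then `v` is elevated — conjugates are irrelevant in a
commutative `π̂₁(𝒢'_v)`, so no Lie/Lazard layer count is needed. [cite: MochizukiSemiAnbd2006, Def 2.4(i) p.25] -/
theorem isElevatedVertex_of_comm_approximators (v : 𝒢.graph.Vertex)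
    (h : ∀ M : ℕ, ∃ A : 𝒢.Approximator, A.IsPiOneEpimorphic ∧ (∀ x y : A.FV v, x * y = y * x) ∧
      ∃ N : Subgroup (A.FV v), M ≤ Nat.card N ∧
        ∀ (b : 𝒢.graph.Branch) (hb : 𝒢.graph.abuts b = some v), N ⊓ (A.brF b v hb).range = ⊥) :
    𝒢.IsElevatedVertex v := by
  intro M
  obtain ⟨A, hA, hcomm, N, hN, hbot⟩ := h M
  refine ⟨A, hA, N, hN, fun b hb g => ?_⟩
  have hmap : (A.brF b v hb).range.map (MulAut.conj g).toMonoidHom = (A.brF b v hb).range := by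
    ext x
    constructor
    · rintro ⟨y, hy, rfl⟩
      have : (MulAut.conj g).toMonoidHom y = y := by
        show g * y * g⁻¹ = y
        rw [hcomm g y, mul_inv_cancel_right]
      rw [this]; exact hy
    · intro hx
      refine ⟨x, hx, ?_⟩
      show g * x * g⁻¹ = x
      rw [hcomm g x, mul_inv_cancel_right]
  rw [hmap]
  exact hbot b hb

/-- Total elevation from commutative approximators at every vertex. [cite: MochizukiSemiAnbd2006, Def 2.4(i) p.25] -/
theorem isTotallyElevated_of_comm_approximators
    (h : ∀ (v : 𝒢.graph.Vertex) (M : ℕ), ∃ A : 𝒢.Approximator, A.IsPiOneEpimorphic ∧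
      (∀ x y : A.FV v, x * y = y * x) ∧
      ∃ N : Subgroup (A.FV v), M ≤ Nat.card N ∧
        ∀ (b : 𝒢.graph.Branch) (hb : 𝒢.graph.abuts b = some v), N ⊓ (A.brF b v hb).range = ⊥) :
    𝒢.IsTotallyElevated := fun v =>
  𝒢.isElevatedVertex_of_comm_approximators v (h v)

/-! ### Appendix (append-only, abc-iut-w6-d102, R5 part 1b): bridges between the two spellings of «branch
subgroup» / «conjugate» used by the R-files — `range α` vs `closure ⟨α 1⟩`, `H.map (MulAut.conj g)` vs
`ConjAct.toConjAct g • H` — so that R2a/R2b's malnormality and cross-estrangement lemmas plug into the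
generic Def 2.4 (iv) constructor above. -/

section Bridges

open scoped Pointwise
open Topology

/-- `g H g⁻¹` in the two Mathlib spellings: `H.map (MulAut.conj g)` is the pointwise `ConjAct`-translate.
[cite: MochizukiSemiAnbd2006, Def 2.4(iv) p.26] -/
theorem map_conj_eq_toConjAct_smul {G : Type*} [Group G] (H : Subgroup G) (g : G) :
    H.map (MulAut.conj g).toMonoidHom = ConjAct.toConjAct g • H := by
  ext x
  rw [Subgroup.mem_map, Subgroup.mem_smul_pointwise_iff_exists]
  constructor
  · rintro ⟨y, hy, rfl⟩
    exact ⟨y, hy, by rw [ConjAct.toConjAct_smul]; rfl⟩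
  · rintro ⟨y, hy, rfl⟩
    exact ⟨y, hy, by rw [ConjAct.toConjAct_smul]; rfl⟩

/-- Symmetry of «trivial intersection with every conjugate»: if `A ∩ g B g⁻¹ = 1` for all `g` then
`B ∩ g A g⁻¹ = 1` for all `g`. [cite: MochizukiSemiAnbd2006, Def 2.4(iv) p.26] -/
theorem inf_map_conj_eq_bot_symm {G : Type*} [Group G] {A B : Subgroup G}
    (h : ∀ g : G, A ⊓ B.map (MulAut.conj g).toMonoidHom = ⊥) (g : G) :
    B ⊓ A.map (MulAut.conj g).toMonoidHom = ⊥ := by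
  rw [eq_bot_iff]
  rintro x ⟨hxB, ⟨y, hyA, rfl⟩⟩
  rw [Subgroup.mem_bot]
  -- `y = g⁻¹ (g y g⁻¹) g ∈ A ∩ g⁻¹ B g`
  have hy : y ∈ A ⊓ B.map (MulAut.conj g⁻¹).toMonoidHom := by
    refine ⟨hyA, ⟨(MulAut.conj g).toMonoidHom y, hxB, ?_⟩⟩
    show g⁻¹ * (g * y * g⁻¹) * g⁻¹⁻¹ = y
    simp [mul_assoc]
  rw [h g⁻¹, Subgroup.mem_bot] at hy
  show g * y * g⁻¹ = 1
  rw [hy, mul_one, mul_inv_cancel]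

/-- The image of a continuous homomorphism out of a COMPACT group topologically generated by one element `e`
into a Hausdorff topological group is the closure of the powers of the image of `e`
(so `Π_b = range(b_*) = closure⟨b_*(1)⟩` for procyclic edge groups). [cite: MochizukiSemiAnbd2006, §2 p.23] -/
theorem range_eq_topologicalClosure_zpowers {E G : Type*} [Group E] [TopologicalSpace E]
    [IsTopologicalGroup E] [CompactSpace E] [Group G] [TopologicalSpace G] [IsTopologicalGroup G]
    [T2Space G] (α : E →ₜ* G) (e : E)
    (he : (Subgroup.zpowers e).topologicalClosure = ⊤) :
    α.toMonoidHom.range = (Subgroup.zpowers (α e)).topologicalClosure := by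
  apply le_antisymm
  · -- `range α = α '' closure ⟨e⟩ ⊆ closure (α '' ⟨e⟩) = closure ⟨α e⟩`
    rintro _ ⟨y, rfl⟩
    have hy : y ∈ (Subgroup.zpowers e).topologicalClosure := by rw [he]; trivial
    have hzp : (Subgroup.zpowers e).map α.toMonoidHom = Subgroup.zpowers (α e) := by
      rw [MonoidHom.map_zpowers]; rfl
    have : α.toMonoidHom y ∈ ((Subgroup.zpowers e).map α.toMonoidHom).topologicalClosure := by
      change α y ∈ closure (α '' ((Subgroup.zpowers e : Subgroup E) : Set E))
      exact (image_closure_subset_closure_image α.continuous) ⟨y, hy, rfl⟩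
    rwa [hzp] at this
  · -- `range α` is closed (compact image in a T2 group) and contains `⟨α e⟩`
    have hclosed : IsClosed (α.toMonoidHom.range : Set G) := by
      have : (α.toMonoidHom.range : Set G) = Set.range α := by ext; simp
      rw [this]
      exact (isCompact_range α.continuous).isClosed
    exact (Subgroup.zpowers (α e)).topologicalClosure_minimal
      ((Subgroup.zpowers_le).mpr ⟨e, rfl⟩) hclosed

/-- An injective homomorphism out of an infinite group has infinite range (`Π_b` infinite for procyclic
`Π_e ≅ ℤ_p` of injective type). [cite: MochizukiSemiAnbd2006, Def 2.1 p.22] -/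
theorem range_infinite_of_injective {E G : Type*} [Group E] [Group G] [Infinite E] (α : E →* G)
    (hα : Function.Injective α) : ((α.range : Subgroup G) : Set G).Infinite := by
  have : Infinite α.range :=
    Infinite.of_injective (fun y : E => ⟨α y, y, rfl⟩) fun _ _ h => hα (congrArg Subtype.val h)
  exact Set.infinite_coe_iff.mp this


end Bridges

end ProfiniteSemiGraph

end Literature.AnabelianGeometry.SemiGraphs
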